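import Summits.AnomalousDissipation.AnomalousDissipation.Theorems.MarginalStabilityChainStrainedLayerLawStubVorticityUniformBoundsD
import Mathlib.Analysis.SpecialFunctions.Sqrt

/-!
# Stub `stub_vorticityUniformBounds` (crux stmt-AnomalousDissipation-3007, line `strain-work-sum-rule`) — tools E:
# Kato's inequality for the weak vorticity balance at one instant

Support file (`--supports stmt-AnomalousDissipation-3007`; registered sub-goal
`stub_vorticityUniformBounds_katoStatic`). Step (a) of the a-priori chain behind the stub is the `L¹`-antitonicity
of the vorticity (Kato). At one instant, test the weak vorticity balance of tools D against
`Φ = j_ε′(ω) ψ(y)` with the regularised modulus `j_ε(s) = √(s² + ε²)` (`ε > 0`) and a nonnegative `C¹` cutoff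
`ψ` vanishing for `|y| ≥ R`:

  `∫∫ j_ε′(ω)ψ (∂ₓb − ∂_ya) ≤ ∫∫ (|ω| + ε)|v − y||ψ′| + ν ∫∫ |∂_yω||ψ′|`

(`stub_vorticityUniformBounds_katoStatic`): the transport term is `∫∫ G_ε(ω)ψ + ∫∫ j_ε(ω)(v − y)ψ′` after
integration by parts (`ω j_ε″(ω)∇ω = ∇G_ε(ω)`, `G_ε = s j_ε′ − j_ε = −ε²/√(s² + ε²) ≤ 0`, `∂ₓu + ∂_yv = 0`), and the
viscous term is `−ν∫∫ j_ε″(ω)|∇ω|²ψ − ν∫∫ j_ε′(ω)∂_yω ψ′` with `j_ε″ ≥ 0`, `|j_ε′| ≤ 1`. The right-hand side only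
sees the transition region of the cutoff; tools F integrate this in time and remove `ε` and the cutoff.
Also here: the calculus of `j_ε` (`kato_hasDerivAt_j/jprime/G`, `kato_sqrt_le`, …). All `[folklore]`
(T. Kato's inequality; e.g. Ben-Artzi, Arch. Rational Mech. Anal. 128 (1994) §2 for the 2-D vorticity equation).
-/

-- `Summit.<Summit>.<Problem>` is the tree's mandated summit-side namespace (CONVENTIONS §2); for this
-- single-conjunct summit the two coincide, so the duplicate is deliberate.
set_option linter.dupNamespace false

noncomputable section

open scoped Topology ENNReal
open Filter Set Function MeasureTheory

namespace Summit.AnomalousDissipation.AnomalousDissipation.Theorems.StrainedLayerLaw.StrainWorkSumRule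

open Literature.Analysis.FluidPDE Literature.Analysis.FluidPDE.StretchedLayer
open Summit.AnomalousDissipation.AnomalousDissipation.Theorems.MarginalStabilityChainStretchedVortexRows

/-! ## The regularised modulus `j_ε(s) = √(s² + ε²)` -/

section Modulus

/-- **Calculus of the regularised modulus `j_ε(s) = √(s² + ε²)` (bundled).** For `ε > 0`: `s² + ε² > 0`, `j_ε > 0`,
`ε ≤ j_ε`, `|s| ≤ j_ε`, `j_ε ≤ |s| + ε`, `|j_ε′| = |s/j_ε| ≤ 1`, `j_ε″ = ε²/((s²+ε²)j_ε) ≥ 0`,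
`G_ε = −ε²/j_ε ≤ 0`, `s j_ε′ − G_ε = j_ε`, and the derivatives of `j_ε`, `j_ε′`, `G_ε` (`G_ε′ = s j_ε″`). Consumers
destructure it with the component names `kato_sq_add_sq_pos, kato_sqrt_pos, kato_le_sqrt, kato_abs_le_sqrt, kato_sqrt_le,
kato_abs_jprime_le_one, kato_jsecond_nonneg, kato_G_nonpos, kato_mul_jprime_sub_G, kato_hasDerivAt_j, kato_hasDerivAt_jprime,
kato_hasDerivAt_G`. [folklore] -/
theorem kato_modulus_props :
    (∀ {ε : ℝ}, 0 < ε → ∀ s : ℝ, 0 < s ^ 2 + ε ^ 2) ∧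
    (∀ {ε : ℝ}, 0 < ε → ∀ s : ℝ, 0 < Real.sqrt (s ^ 2 + ε ^ 2)) ∧
    (∀ {ε : ℝ}, 0 < ε → ∀ s : ℝ, ε ≤ Real.sqrt (s ^ 2 + ε ^ 2)) ∧
    (∀ s ε : ℝ, |s| ≤ Real.sqrt (s ^ 2 + ε ^ 2)) ∧
    (∀ {ε : ℝ}, 0 < ε → ∀ s : ℝ, Real.sqrt (s ^ 2 + ε ^ 2) ≤ |s| + ε) ∧
    (∀ {ε : ℝ}, 0 < ε → ∀ s : ℝ, |s / Real.sqrt (s ^ 2 + ε ^ 2)| ≤ 1) ∧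
    (∀ {ε : ℝ}, 0 < ε → ∀ s : ℝ, 0 ≤ ε ^ 2 / ((s ^ 2 + ε ^ 2) * Real.sqrt (s ^ 2 + ε ^ 2))) ∧
    (∀ {ε : ℝ}, 0 < ε → ∀ s : ℝ, -ε ^ 2 / Real.sqrt (s ^ 2 + ε ^ 2) ≤ 0) ∧
    (∀ {ε : ℝ}, 0 < ε → ∀ s : ℝ,
      s * (s / Real.sqrt (s ^ 2 + ε ^ 2)) - -ε ^ 2 / Real.sqrt (s ^ 2 + ε ^ 2) = Real.sqrt (s ^ 2 + ε ^ 2)) ∧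
    (∀ {ε : ℝ}, 0 < ε → ∀ s : ℝ,
      HasDerivAt (fun s => Real.sqrt (s ^ 2 + ε ^ 2)) (s / Real.sqrt (s ^ 2 + ε ^ 2)) s) ∧
    (∀ {ε : ℝ}, 0 < ε → ∀ s : ℝ, HasDerivAt (fun s => s / Real.sqrt (s ^ 2 + ε ^ 2))
      (ε ^ 2 / ((s ^ 2 + ε ^ 2) * Real.sqrt (s ^ 2 + ε ^ 2))) s) ∧
    (∀ {ε : ℝ}, 0 < ε → ∀ s : ℝ, HasDerivAt (fun s => -ε ^ 2 / Real.sqrt (s ^ 2 + ε ^ 2))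
      (s * (ε ^ 2 / ((s ^ 2 + ε ^ 2) * Real.sqrt (s ^ 2 + ε ^ 2)))) s) := by
  have hp : ∀ {ε : ℝ}, 0 < ε → ∀ s : ℝ, 0 < s ^ 2 + ε ^ 2 := fun hε s => by positivity
  have hr : ∀ {ε : ℝ}, 0 < ε → ∀ s : ℝ, 0 < Real.sqrt (s ^ 2 + ε ^ 2) := fun hε s => Real.sqrt_pos.2 (hp hε s)
  have habs : ∀ s ε : ℝ, |s| ≤ Real.sqrt (s ^ 2 + ε ^ 2) := fun s ε => Real.abs_le_sqrt (by nlinarith [sq_nonneg ε])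
  have hj : ∀ {ε : ℝ}, 0 < ε → ∀ s : ℝ,
      HasDerivAt (fun s => Real.sqrt (s ^ 2 + ε ^ 2)) (s / Real.sqrt (s ^ 2 + ε ^ 2)) s := by
    intro ε hε s
    have h1 : HasDerivAt (fun s => s ^ 2 + ε ^ 2) (2 * s) s := by
      simpa using ((hasDerivAt_pow 2 s).add_const (ε ^ 2))
    have h2 := h1.sqrt (hp hε s).ne'
    convert h2 using 1
    field_simp
  refine ⟨hp, hr, fun {ε} hε s => ?_, habs, fun {ε} hε s => ?_, fun {ε} hε s => ?_, fun {ε} hε s => ?_,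
    fun {ε} hε s => ?_, fun {ε} hε s => ?_, hj, fun {ε} hε s => ?_, fun {ε} hε s => ?_⟩
  · calc ε = |ε| := (abs_of_pos hε).symm
      _ ≤ Real.sqrt (s ^ 2 + ε ^ 2) := Real.abs_le_sqrt (by nlinarith [sq_nonneg s])
  · rw [Real.sqrt_le_iff]
    exact ⟨by positivity, by nlinarith [abs_nonneg s, sq_abs s, hε.le]⟩
  · rw [abs_div, abs_of_pos (hr hε s), div_le_one (hr hε s)]; exact habs s ε
  · have := hr hε s; positivity
  · exact div_nonpos_of_nonpos_of_nonneg (by nlinarith [sq_nonneg ε]) (hr hε s).le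
  · have h0 := hr hε s
    have hr2 : Real.sqrt (s ^ 2 + ε ^ 2) ^ 2 = s ^ 2 + ε ^ 2 := Real.sq_sqrt (hp hε s).le
    field_simp
    nlinarith [hr2]
  · have h0 := hr hε s
    have hr2 : Real.sqrt (s ^ 2 + ε ^ 2) ^ 2 = s ^ 2 + ε ^ 2 := Real.sq_sqrt (hp hε s).le
    have h := (hasDerivAt_id s).div (hj hε s) h0.ne'
    refine h.congr_deriv ?_
    rw [hr2, id, one_mul, div_eq_div_iff (hp hε s).ne' (mul_pos (hp hε s) h0).ne']
    have h3 : Real.sqrt (s ^ 2 + ε ^ 2) * Real.sqrt (s ^ 2 + ε ^ 2) = s ^ 2 + ε ^ 2 := by rw [← sq, hr2]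
    field_simp
    nlinarith [h3, h0]
  · have h0 := hr hε s
    have hr2 : Real.sqrt (s ^ 2 + ε ^ 2) ^ 2 = s ^ 2 + ε ^ 2 := Real.sq_sqrt (hp hε s).le
    have h := ((hj hε s).inv h0.ne').const_mul (-ε ^ 2)
    have hfun : (fun s => -ε ^ 2 / Real.sqrt (s ^ 2 + ε ^ 2)) = fun s => -ε ^ 2 * (Real.sqrt (s ^ 2 + ε ^ 2))⁻¹ :=
      funext fun s => div_eq_mul_inv _ _
    rw [hfun]
    refine h.congr_deriv ?_
    rw [hr2]
    field_simp

end Modulus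

/-! ## Kato's inequality for the weak vorticity balance, at one instant -/

section KatoStatic

/-- **Kato's inequality for the stretched layer, at one instant (registered sub-goal
`stub_vorticityUniformBounds_katoStatic`).** In the setting of `stub_vorticityUniformBounds_weakVorticity`
(`ν ≥ 0`), test the weak vorticity balance against `Φ = j_ε′(ω) ψ(y)`, `j_ε(s) = √(s² + ε²)` (`ε > 0`),
`ψ ∈ C¹(ℝ)` nonnegative and vanishing for `|y| ≥ R`:
`∫∫ j_ε′(ω)ψ (∂ₓb − ∂_ya) ≤ ∫∫ (|ω| + ε)|v − y||ψ′| + ν ∫∫ |∂_yω||ψ′|`.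
(Transport: `ω j_ε″(ω)∇ω = ∇G_ε(ω)`, `G_ε = s j_ε′ − j_ε = −ε²/√(s² + ε²) ∈ [−ε, 0]`; after integration by
parts and `∂ₓu + ∂_yv = 1 − 1`... = 0 it equals `∫∫ G_ε(ω)ψ + ∫∫ j_ε(ω)(v − y)ψ′ ≤ ∫∫ (|ω| + ε)|v − y||ψ′|`.
Viscosity: `−ν∫∫ (j_ε″(ω)|∇ω|²ψ + j_ε′(ω)∂_yω ψ′) ≤ ν∫∫ |∂_yω||ψ′|`.) The right-hand side only sees the
transition region of the cutoff. [folklore] -/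
theorem stub_vorticityUniformBounds_katoStatic : ∀ (L ν R ε : ℝ) (u v p a b : ℝ → ℝ → ℝ) (ψ : ℝ → ℝ),
    0 < L → 0 ≤ ν → 0 < ε →
    ContDiff ℝ 2 (fun q : ℝ × ℝ => u q.1 q.2) → ContDiff ℝ 2 (fun q : ℝ × ℝ => v q.1 q.2) →
    ContDiff ℝ 1 (fun q : ℝ × ℝ => p q.1 q.2) → ContDiff ℝ 1 (fun q : ℝ × ℝ => a q.1 q.2) →
    ContDiff ℝ 1 (fun q : ℝ × ℝ => b q.1 q.2) →
    (∀ x y, a x y + u x y * dX u x y + (v x y - y) * dY u x y = -dX p x y + ν * lap u x y) →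
    (∀ x y, b x y + u x y * dX v x y + (v x y - y) * dY v x y - v x y = -dY p x y + ν * lap v x y) →
    (∀ x y, dX u x y + dY v x y = 0) →
    (∀ x y, u (x + L) y = u x y) → (∀ x y, v (x + L) y = v x y) → (∀ x y, p (x + L) y = p x y) →
    (∀ x y, b (x + L) y = b x y) →
    ContDiff ℝ 1 ψ → (∀ y, 0 ≤ ψ y) → (∀ y, R ≤ |y| → ψ y = 0) →
      ∫ q in Ioc 0 L ×ˢ univ, vorticity u v q.1 q.2 / Real.sqrt (vorticity u v q.1 q.2 ^ 2 + ε ^ 2) * ψ q.2 *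
          (dX b q.1 q.2 - dY a q.1 q.2) ≤
        (∫ q in Ioc 0 L ×ˢ univ, (|vorticity u v q.1 q.2| + ε) * |v q.1 q.2 - q.2| * |deriv ψ q.2|) +
          ν * ∫ q in Ioc 0 L ×ˢ univ, |dY (vorticity u v) q.1 q.2| * |deriv ψ q.2| := by
  obtain ⟨kato_sq_add_sq_pos, kato_sqrt_pos, kato_le_sqrt, kato_abs_le_sqrt, kato_sqrt_le, kato_abs_jprime_le_one,
    kato_jsecond_nonneg, kato_G_nonpos, kato_mul_jprime_sub_G, kato_hasDerivAt_j, kato_hasDerivAt_jprime,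
    kato_hasDerivAt_G⟩ := kato_modulus_props
  intro L ν R ε u v p a b ψ hL hν hε hu hv hp ha hb hmx hmy hdiv huper hvper hpper hbper hψ hψ0 hψR
  -- notation: `ω`, `j′`, `j″`, `G`, the test function `Φ = j′(ω) ψ`
  set ω : ℝ → ℝ → ℝ := vorticity u v with hωdef
  set jp : ℝ → ℝ := fun s => s / Real.sqrt (s ^ 2 + ε ^ 2) with hjp
  set jpp : ℝ → ℝ := fun s => ε ^ 2 / ((s ^ 2 + ε ^ 2) * Real.sqrt (s ^ 2 + ε ^ 2)) with hjpp
  set G : ℝ → ℝ := fun s => -ε ^ 2 / Real.sqrt (s ^ 2 + ε ^ 2) with hG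
  set Φ : ℝ → ℝ → ℝ := fun x y => jp (ω x y) * ψ y with hΦdef
  -- regularity
  have hu1 : ContDiff ℝ 1 (fun q : ℝ × ℝ => u q.1 q.2) := hu.of_le one_le_two
  have hv1 : ContDiff ℝ 1 (fun q : ℝ × ℝ => v q.1 q.2) := hv.of_le one_le_two
  have hω1 : ContDiff ℝ 1 (fun q : ℝ × ℝ => ω q.1 q.2) := contDiff_one_vorticity hu hv
  have hjp1 : ContDiff ℝ 1 jp := by
    refine contDiff_id.div (ContDiff.sqrt (by fun_prop) fun s => (kato_sq_add_sq_pos hε s).ne') fun s => ?_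
    exact (kato_sqrt_pos hε s).ne'
  have hG1 : ContDiff ℝ 1 G := by
    refine contDiff_const.div (ContDiff.sqrt (by fun_prop) fun s => (kato_sq_add_sq_pos hε s).ne') fun s => ?_
    exact (kato_sqrt_pos hε s).ne'
  have hΦ1 : ContDiff ℝ 1 (fun q : ℝ × ℝ => Φ q.1 q.2) := (hjp1.comp hω1).mul (hψ.comp contDiff_snd)
  have cψ : Continuous ψ := hψ.continuous
  have cψ' : Continuous (deriv ψ) := hψ.continuous_deriv le_rfl
  have cu : Continuous fun q : ℝ × ℝ => u q.1 q.2 := hu.continuous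
  have cv : Continuous fun q : ℝ × ℝ => v q.1 q.2 := hv.continuous
  have cux : Continuous fun q : ℝ × ℝ => dX u q.1 q.2 := continuous_dX hu1
  have cvy : Continuous fun q : ℝ × ℝ => dY v q.1 q.2 := continuous_dY hv1
  have cω : Continuous fun q : ℝ × ℝ => ω q.1 q.2 := hω1.continuous
  have cωx : Continuous fun q : ℝ × ℝ => dX ω q.1 q.2 := continuous_dX hω1
  have cωy : Continuous fun q : ℝ × ℝ => dY ω q.1 q.2 := continuous_dY hω1
  have cjp : Continuous jp := hjp1.continuous
  have cjpp : Continuous jpp := by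
    simp only [hjpp]
    exact continuous_const.div ((by fun_prop : Continuous fun s : ℝ => s ^ 2 + ε ^ 2).mul
      (Real.continuous_sqrt.comp (by fun_prop))) fun s => (mul_pos (kato_sq_add_sq_pos hε s) (kato_sqrt_pos hε s)).ne'
  have cG : Continuous G := hG1.continuous
  have cΦx : Continuous fun q : ℝ × ℝ => dX Φ q.1 q.2 := continuous_dX hΦ1
  have cΦy : Continuous fun q : ℝ × ℝ => dY Φ q.1 q.2 := continuous_dY hΦ1
  -- periodicity and support of the test function
  have hωper : ∀ x y, ω (x + L) y = ω x y := fun x y => by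
    simp only [hωdef, vorticity]; rw [dX_periodic hvper, dY_periodic huper]
  have hΦper : ∀ x y, Φ (x + L) y = Φ x y := fun x y => by simp only [hΦdef, hωper]
  have hΦ0 : ∀ x y, R ≤ |y| → Φ x y = 0 := fun x y hy => by simp only [hΦdef, hψR y hy, mul_zero]
  have hψ'0 : ∀ y, R + 1 ≤ |y| → deriv ψ y = 0 := fun y hy =>
    kato_dY_eq_zero (Φ := fun _ s => ψ s) (x := (0:ℝ)) (fun _ s hs => hψR s hs) hy
  -- the slice derivatives of `Φ`
  have hωx : ∀ x y, HasDerivAt (fun s => ω s y) (dX ω x y) x := hasDerivAt_dX_of_contDiff hω1 one_ne_zero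
  have hωy : ∀ x y, HasDerivAt (fun s => ω x s) (dY ω x y) y := hasDerivAt_dY_of_contDiff hω1 one_ne_zero
  have hψd : ∀ y, HasDerivAt ψ (deriv ψ y) y := fun y => (hψ.differentiable one_ne_zero y).hasDerivAt
  have hjpd : ∀ s, HasDerivAt jp (jpp s) s := fun s => kato_hasDerivAt_jprime hε s
  have hΦx : ∀ x y, dX Φ x y = jpp (ω x y) * dX ω x y * ψ y := fun x y => by
    have h := (HasDerivAt.comp (h₂ := jp) (h := fun s => ω s y) x (hjpd (ω x y)) (hωx x y)).mul_const (ψ y)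
    exact h.deriv
  have hΦy : ∀ x y, dY Φ x y = jpp (ω x y) * dY ω x y * ψ y + jp (ω x y) * deriv ψ y := fun x y => by
    have h := (HasDerivAt.comp (h₂ := jp) (h := fun s => ω x s) y (hjpd (ω x y)) (hωy x y)).mul (hψd y)
    exact h.deriv
  -- the weak vorticity balance tested against `Φ`
  have key := stub_vorticityUniformBounds_weakVorticity L ν R u v p a b Φ hL hu hv hp ha hb hΦ1 hmx hmy hdiv
    huper hvper hpper hbper hΦper hΦ0
  rw [show (fun q : ℝ × ℝ => jp (vorticity u v q.1 q.2) * ψ q.2 * (dX b q.1 q.2 - dY a q.1 q.2)) =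
    fun q : ℝ × ℝ => Φ q.1 q.2 * (dX b q.1 q.2 - dY a q.1 q.2) from rfl, key]
  -- integrability helpers: a factor `ψ` or `ψ′`
  have hIψ : ∀ F : ℝ × ℝ → ℝ, Continuous F →
      IntegrableOn (fun q : ℝ × ℝ => F q * ψ q.2) (Ioc 0 L ×ˢ univ) := fun F hF =>
    kato_integrableOn_strip_of_eq_zero (R := R) (hF.mul (cψ.comp continuous_snd)) fun x _ y hy => by
      simp only [hψR y hy, mul_zero]
  have hIψ' : ∀ F : ℝ × ℝ → ℝ, Continuous F →
      IntegrableOn (fun q : ℝ × ℝ => F q * deriv ψ q.2) (Ioc 0 L ×ˢ univ) := fun F hF =>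
    kato_integrableOn_strip_of_eq_zero (R := R + 1) (hF.mul (cψ'.comp continuous_snd)) fun x _ y hy => by
      simp only [hψ'0 y hy, mul_zero]
  ------------------------------------------------------------------
  -- the transport part
  ------------------------------------------------------------------
  have hT : ∫ q in Ioc 0 L ×ˢ univ, ω q.1 q.2 * (u q.1 q.2 * dX Φ q.1 q.2 + (v q.1 q.2 - q.2) * dY Φ q.1 q.2) ≤
      ∫ q in Ioc 0 L ×ˢ univ, (|ω q.1 q.2| + ε) * |v q.1 q.2 - q.2| * |deriv ψ q.2| := by
    -- `G′(ω) ∇ω`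
    have hGd : ∀ s, HasDerivAt G (s * jpp s) s := fun s => kato_hasDerivAt_G hε s
    have hGx : ∀ x y, HasDerivAt (fun s => G (ω s y)) (ω x y * jpp (ω x y) * dX ω x y) x := fun x y =>
      HasDerivAt.comp (h₂ := G) (h := fun s => ω s y) x (hGd (ω x y)) (hωx x y)
    have hGy : ∀ x y, HasDerivAt (fun s => G (ω x s)) (ω x y * jpp (ω x y) * dY ω x y) y := fun x y =>
      HasDerivAt.comp (h₂ := G) (h := fun s => ω x s) y (hGd (ω x y)) (hωy x y)
    -- integration by parts in `x`: `∫∫ (uψ) ∂ₓG(ω) = −∫∫ (∂ₓu ψ) G(ω)`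
    have ibx : ∫ q in Ioc 0 L ×ˢ univ, (u q.1 q.2 * ψ q.2) * (ω q.1 q.2 * jpp (ω q.1 q.2) * dX ω q.1 q.2) =
        -∫ q in Ioc 0 L ×ˢ univ, (dX u q.1 q.2 * ψ q.2) * G (ω q.1 q.2) := by
      refine integral_strip_mul_dX_eq_neg hL.le (f := fun x y => u x y * ψ y) (g := fun x y => G (ω x y))
        (f' := fun x y => dX u x y * ψ y) (g' := fun x y => ω x y * jpp (ω x y) * dX ω x y)
        (fun x y => (hasDerivAt_dX_of_contDiff hu two_ne_zero x y).mul_const (ψ y)) hGx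
        (fun y => by fun_prop) (fun y => by fun_prop) (fun y => ?_) ?_ ?_
      · have h1 := huper 0 y; have h2 := hωper 0 y
        rw [zero_add] at h1 h2
        rw [h1, h2]
      · have := hIψ (fun q => u q.1 q.2 * (ω q.1 q.2 * jpp (ω q.1 q.2) * dX ω q.1 q.2)) (by fun_prop)
        refine this.congr_fun (fun q _ => ?_) (measurableSet_Ioc.prod MeasurableSet.univ)
        simp only; ring
      · have := hIψ (fun q => dX u q.1 q.2 * G (ω q.1 q.2)) (by fun_prop)
        refine this.congr_fun (fun q _ => ?_) (measurableSet_Ioc.prod MeasurableSet.univ)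
        simp only; ring
    -- integration by parts in `y`: `∫∫ ((v − y)ψ) ∂_yG(ω) = −∫∫ ((∂_yv − 1)ψ + (v − y)ψ′) G(ω)`
    have iby : ∫ q in Ioc 0 L ×ˢ univ, ((v q.1 q.2 - q.2) * ψ q.2) * (ω q.1 q.2 * jpp (ω q.1 q.2) * dY ω q.1 q.2) =
        -∫ q in Ioc 0 L ×ˢ univ, ((dY v q.1 q.2 - 1) * ψ q.2 + (v q.1 q.2 - q.2) * deriv ψ q.2) * G (ω q.1 q.2) := by
      refine integral_strip_mul_dY_eq_neg (f := fun x y => (v x y - y) * ψ y) (g := fun x y => G (ω x y))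
        (f' := fun x y => (dY v x y - 1) * ψ y + (v x y - y) * deriv ψ y)
        (g' := fun x y => ω x y * jpp (ω x y) * dY ω x y)
        (fun x y => ((hasDerivAt_dY_of_contDiff hv two_ne_zero x y).sub (hasDerivAt_id y)).mul (hψd y))
        hGy ?_ ?_ ?_
      · have := hIψ (fun q => (v q.1 q.2 - q.2) * (ω q.1 q.2 * jpp (ω q.1 q.2) * dY ω q.1 q.2)) (by fun_prop)
        refine this.congr_fun (fun q _ => ?_) (measurableSet_Ioc.prod MeasurableSet.univ)
        simp only; ring
      · have h1 := hIψ (fun q => (dY v q.1 q.2 - 1) * G (ω q.1 q.2)) (by fun_prop)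
        have h2 := hIψ' (fun q => (v q.1 q.2 - q.2) * G (ω q.1 q.2)) (by fun_prop)
        have h12 : IntegrableOn (fun q : ℝ × ℝ => (dY v q.1 q.2 - 1) * G (ω q.1 q.2) * ψ q.2 +
            (v q.1 q.2 - q.2) * G (ω q.1 q.2) * deriv ψ q.2) (Ioc 0 L ×ˢ univ) := h1.add h2
        refine h12.congr_fun (fun q _ => ?_) (measurableSet_Ioc.prod MeasurableSet.univ)
        simp only; ring
      · have := hIψ (fun q => (v q.1 q.2 - q.2) * G (ω q.1 q.2)) (by fun_prop)
        refine this.congr_fun (fun q _ => ?_) (measurableSet_Ioc.prod MeasurableSet.univ)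
        simp only; ring
    -- integrability of the four pieces
    have iA : IntegrableOn (fun q : ℝ × ℝ => (u q.1 q.2 * ψ q.2) * (ω q.1 q.2 * jpp (ω q.1 q.2) * dX ω q.1 q.2))
        (Ioc 0 L ×ˢ univ) := by
      have := hIψ (fun q => u q.1 q.2 * (ω q.1 q.2 * jpp (ω q.1 q.2) * dX ω q.1 q.2)) (by fun_prop)
      refine this.congr_fun (fun q _ => ?_) (measurableSet_Ioc.prod MeasurableSet.univ)
      simp only; ring
    have iB : IntegrableOn (fun q : ℝ × ℝ => ((v q.1 q.2 - q.2) * ψ q.2) * (ω q.1 q.2 * jpp (ω q.1 q.2) * dY ω q.1 q.2))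
        (Ioc 0 L ×ˢ univ) := by
      have := hIψ (fun q => (v q.1 q.2 - q.2) * (ω q.1 q.2 * jpp (ω q.1 q.2) * dY ω q.1 q.2)) (by fun_prop)
      refine this.congr_fun (fun q _ => ?_) (measurableSet_Ioc.prod MeasurableSet.univ)
      simp only; ring
    have iC : IntegrableOn (fun q : ℝ × ℝ => ω q.1 q.2 * jp (ω q.1 q.2) * (v q.1 q.2 - q.2) * deriv ψ q.2)
        (Ioc 0 L ×ˢ univ) := hIψ' (fun q => ω q.1 q.2 * jp (ω q.1 q.2) * (v q.1 q.2 - q.2)) (by fun_prop)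
    have iD : IntegrableOn (fun q : ℝ × ℝ => (dX u q.1 q.2 * ψ q.2) * G (ω q.1 q.2)) (Ioc 0 L ×ˢ univ) := by
      have := hIψ (fun q => dX u q.1 q.2 * G (ω q.1 q.2)) (by fun_prop)
      refine this.congr_fun (fun q _ => ?_) (measurableSet_Ioc.prod MeasurableSet.univ)
      simp only; ring
    have iE : IntegrableOn (fun q : ℝ × ℝ => ((dY v q.1 q.2 - 1) * ψ q.2 + (v q.1 q.2 - q.2) * deriv ψ q.2) *
        G (ω q.1 q.2)) (Ioc 0 L ×ˢ univ) := by
      have h1 := hIψ (fun q => (dY v q.1 q.2 - 1) * G (ω q.1 q.2)) (by fun_prop)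
      have h2 := hIψ' (fun q => (v q.1 q.2 - q.2) * G (ω q.1 q.2)) (by fun_prop)
      have h12 : IntegrableOn (fun q : ℝ × ℝ => (dY v q.1 q.2 - 1) * G (ω q.1 q.2) * ψ q.2 +
          (v q.1 q.2 - q.2) * G (ω q.1 q.2) * deriv ψ q.2) (Ioc 0 L ×ˢ univ) := h1.add h2
      refine h12.congr_fun (fun q _ => ?_) (measurableSet_Ioc.prod MeasurableSet.univ)
      simp only; ring
    have iP : IntegrableOn (fun q : ℝ × ℝ => G (ω q.1 q.2) * ψ q.2) (Ioc 0 L ×ˢ univ) :=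
      hIψ (fun q => G (ω q.1 q.2)) (by fun_prop)
    have iQ : IntegrableOn (fun q : ℝ × ℝ => Real.sqrt (ω q.1 q.2 ^ 2 + ε ^ 2) * (v q.1 q.2 - q.2) * deriv ψ q.2)
        (Ioc 0 L ×ˢ univ) :=
      hIψ' (fun q => Real.sqrt (ω q.1 q.2 ^ 2 + ε ^ 2) * (v q.1 q.2 - q.2)) (by fun_prop)
    have iR : IntegrableOn (fun q : ℝ × ℝ => (|ω q.1 q.2| + ε) * |v q.1 q.2 - q.2| * |deriv ψ q.2|)
        (Ioc 0 L ×ˢ univ) :=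
      kato_integrableOn_strip_of_eq_zero (R := R + 1) (by fun_prop) fun x _ y hy => by
        simp only [hψ'0 y hy, abs_zero, mul_zero]
    -- split the transport integrand
    have e1 : ∫ q in Ioc 0 L ×ˢ univ, ω q.1 q.2 * (u q.1 q.2 * dX Φ q.1 q.2 + (v q.1 q.2 - q.2) * dY Φ q.1 q.2) =
        (∫ q in Ioc 0 L ×ˢ univ, (u q.1 q.2 * ψ q.2) * (ω q.1 q.2 * jpp (ω q.1 q.2) * dX ω q.1 q.2)) +
        (∫ q in Ioc 0 L ×ˢ univ, ((v q.1 q.2 - q.2) * ψ q.2) * (ω q.1 q.2 * jpp (ω q.1 q.2) * dY ω q.1 q.2)) +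
        ∫ q in Ioc 0 L ×ˢ univ, ω q.1 q.2 * jp (ω q.1 q.2) * (v q.1 q.2 - q.2) * deriv ψ q.2 := by
      have iAB : IntegrableOn (fun q : ℝ × ℝ => (u q.1 q.2 * ψ q.2) * (ω q.1 q.2 * jpp (ω q.1 q.2) * dX ω q.1 q.2) +
          ((v q.1 q.2 - q.2) * ψ q.2) * (ω q.1 q.2 * jpp (ω q.1 q.2) * dY ω q.1 q.2)) (Ioc 0 L ×ˢ univ) := iA.add iB
      rw [← integral_add iA iB, ← integral_add iAB iC]
      refine integral_congr_ae (Eventually.of_forall fun q => ?_)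
      simp only
      rw [hΦx, hΦy]
      ring
    -- recombine after the integrations by parts
    have e2 : (-∫ q in Ioc 0 L ×ˢ univ, (dX u q.1 q.2 * ψ q.2) * G (ω q.1 q.2)) +
        (-∫ q in Ioc 0 L ×ˢ univ, ((dY v q.1 q.2 - 1) * ψ q.2 + (v q.1 q.2 - q.2) * deriv ψ q.2) * G (ω q.1 q.2)) +
        (∫ q in Ioc 0 L ×ˢ univ, ω q.1 q.2 * jp (ω q.1 q.2) * (v q.1 q.2 - q.2) * deriv ψ q.2) =
        (∫ q in Ioc 0 L ×ˢ univ, G (ω q.1 q.2) * ψ q.2) +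
          ∫ q in Ioc 0 L ×ˢ univ, Real.sqrt (ω q.1 q.2 ^ 2 + ε ^ 2) * (v q.1 q.2 - q.2) * deriv ψ q.2 := by
      have iDE : IntegrableOn (fun q : ℝ × ℝ => -((dX u q.1 q.2 * ψ q.2) * G (ω q.1 q.2)) +
          -(((dY v q.1 q.2 - 1) * ψ q.2 + (v q.1 q.2 - q.2) * deriv ψ q.2) * G (ω q.1 q.2))) (Ioc 0 L ×ˢ univ) :=
        iD.neg.add iE.neg
      have iDEC : IntegrableOn (fun q : ℝ × ℝ => -((dX u q.1 q.2 * ψ q.2) * G (ω q.1 q.2)) +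
          -(((dY v q.1 q.2 - 1) * ψ q.2 + (v q.1 q.2 - q.2) * deriv ψ q.2) * G (ω q.1 q.2)) +
          ω q.1 q.2 * jp (ω q.1 q.2) * (v q.1 q.2 - q.2) * deriv ψ q.2) (Ioc 0 L ×ˢ univ) := iDE.add iC
      have iDn : IntegrableOn (fun q : ℝ × ℝ => -((dX u q.1 q.2 * ψ q.2) * G (ω q.1 q.2))) (Ioc 0 L ×ˢ univ) :=
        iD.neg
      have iEn : IntegrableOn (fun q : ℝ × ℝ => -(((dY v q.1 q.2 - 1) * ψ q.2 + (v q.1 q.2 - q.2) * deriv ψ q.2) *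
          G (ω q.1 q.2))) (Ioc 0 L ×ˢ univ) := iE.neg
      rw [← integral_neg, ← integral_neg, ← integral_add iDn iEn, ← integral_add iDE iC,
        ← integral_add iP iQ]
      refine integral_congr_ae (Eventually.of_forall fun q => ?_)
      simp only
      have h1 : dX u q.1 q.2 + dY v q.1 q.2 = 0 := hdiv q.1 q.2
      have h2 := kato_mul_jprime_sub_G hε (ω q.1 q.2)
      simp only [hjp, hG] at h2 ⊢
      have h3 : dY v q.1 q.2 = -dX u q.1 q.2 := by linarith
      rw [h3]
      linear_combination (v q.1 q.2 - q.2) * deriv ψ q.2 * h2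
    -- signs
    have e3 : ∫ q in Ioc 0 L ×ˢ univ, G (ω q.1 q.2) * ψ q.2 ≤ 0 :=
      integral_nonpos fun q => mul_nonpos_of_nonpos_of_nonneg (kato_G_nonpos hε _) (hψ0 _)
    have e4 : ∫ q in Ioc 0 L ×ˢ univ, Real.sqrt (ω q.1 q.2 ^ 2 + ε ^ 2) * (v q.1 q.2 - q.2) * deriv ψ q.2 ≤
        ∫ q in Ioc 0 L ×ˢ univ, (|ω q.1 q.2| + ε) * |v q.1 q.2 - q.2| * |deriv ψ q.2| := by
      refine integral_mono iQ iR fun q => ?_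
      simp only
      have h1 := kato_sqrt_le hε (ω q.1 q.2)
      have h2 : Real.sqrt (ω q.1 q.2 ^ 2 + ε ^ 2) * (v q.1 q.2 - q.2) * deriv ψ q.2 ≤
          |Real.sqrt (ω q.1 q.2 ^ 2 + ε ^ 2) * (v q.1 q.2 - q.2) * deriv ψ q.2| := le_abs_self _
      rw [abs_mul, abs_mul, abs_of_pos (kato_sqrt_pos hε _)] at h2
      exact h2.trans (mul_le_mul_of_nonneg_right (mul_le_mul_of_nonneg_right h1 (abs_nonneg _)) (abs_nonneg _))
    rw [e1, ibx, iby]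
    linarith [e2, e3, e4]
  ------------------------------------------------------------------
  -- the viscous part
  ------------------------------------------------------------------
  have hV : -(∫ q in Ioc 0 L ×ˢ univ, |dY ω q.1 q.2| * |deriv ψ q.2|) ≤
      ∫ q in Ioc 0 L ×ˢ univ, (dX ω q.1 q.2 * dX Φ q.1 q.2 + dY ω q.1 q.2 * dY Φ q.1 q.2) := by
    rw [← integral_neg]
    have i1 : IntegrableOn (fun q : ℝ × ℝ => -(|dY ω q.1 q.2| * |deriv ψ q.2|)) (Ioc 0 L ×ˢ univ) :=
      kato_integrableOn_strip_of_eq_zero (R := R + 1) (by fun_prop) fun x _ y hy => by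
        simp only [hψ'0 y hy, abs_zero, mul_zero, neg_zero]
    have i2 : IntegrableOn (fun q : ℝ × ℝ => dX ω q.1 q.2 * dX Φ q.1 q.2 + dY ω q.1 q.2 * dY Φ q.1 q.2)
        (Ioc 0 L ×ˢ univ) := by
      refine kato_integrableOn_strip_of_eq_zero (R := R + 1) (by fun_prop) fun x _ y hy => ?_
      rw [kato_dX_eq_zero hΦ0 (by linarith : R ≤ |y|), kato_dY_eq_zero hΦ0 hy, mul_zero, mul_zero, add_zero]
    refine integral_mono i1 i2 fun q => ?_
    simp only
    rw [hΦx, hΦy]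
    have h1 : 0 ≤ jpp (ω q.1 q.2) * (dX ω q.1 q.2 ^ 2 + dY ω q.1 q.2 ^ 2) * ψ q.2 :=
      mul_nonneg (mul_nonneg (kato_jsecond_nonneg hε _) (by positivity)) (hψ0 _)
    have h2 : -(|dY ω q.1 q.2| * |deriv ψ q.2|) ≤ dY ω q.1 q.2 * (jp (ω q.1 q.2) * deriv ψ q.2) := by
      rw [← abs_mul]
      have h3 : |dY ω q.1 q.2 * (jp (ω q.1 q.2) * deriv ψ q.2)| ≤ |dY ω q.1 q.2 * deriv ψ q.2| := by
        rw [abs_mul, abs_mul, abs_mul]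
        have := kato_abs_jprime_le_one hε (ω q.1 q.2)
        nlinarith [abs_nonneg (dY ω q.1 q.2), abs_nonneg (deriv ψ q.2), abs_nonneg (jp (ω q.1 q.2)),
          mul_nonneg (abs_nonneg (dY ω q.1 q.2)) (abs_nonneg (deriv ψ q.2))]
      linarith [neg_abs_le (dY ω q.1 q.2 * (jp (ω q.1 q.2) * deriv ψ q.2))]
    nlinarith [h1, h2]
  -- conclusion
  have hνV := mul_le_mul_of_nonneg_left hV hν
  linarith [hT, hνV]

end KatoStatic

end Summit.AnomalousDissipation.AnomalousDissipation.Theorems.StrainedLayerLaw.StrainWorkSumRule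

end
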